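import Literature.MathematicalPhysics.QuantumFieldTheory.ConformalBootstrap3D.MeanFieldDecomposition
import Mathlib.Tactic
import HarnessLib

/-!
# The two mean-field decompositions over ALL spins: `(u/v)^p = Σ P_{n,ℓ} g` and `u^p = Σ (-1)^ℓ P_{n,ℓ} g`

`MeanFieldDecomposition` proves the even-spin decomposition of the generalised free four-point function
`u^p + (u/v)^p = Σ_{n,ℓ} (1+(-1)^ℓ) P_{n,ℓ}(p) g_{2p+2n+ℓ,ℓ}` (`hasSum_meanField_blocks`), the sum of the two
formal identities of `MeanFieldSources` (`blockSum_mft_eq_ggArr`: `(u/v)^p`-family; `blockSum_mft_alt_eq_delta`: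
`u^p`-family). This file separates them analytically, for every real `p > 1/2` and `z, z̄ ∈ (0,1)`:

* `hasSum_mft_blocks_uv` : `HasSum (n,ℓ) ↦ P_{n,ℓ}(p) g_{2p+2n+ℓ,ℓ}(z,z̄)` with sum `(z z̄)^p ((1-z)(1-z̄))^{-p} = (u/v)^p`
  — ALL spins `ℓ`, every coefficient positive (`mftCoeff_pos`);
* `hasSum_mft_blocks_u`  : `HasSum (n,ℓ) ↦ (-1)^ℓ P_{n,ℓ}(p) g_{2p+2n+ℓ,ℓ}(z,z̄)` with sum `(z z̄)^p = u^p`.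

These are the conformal block decompositions of the two orderings of the four-point function of two
DECOUPLED generalised free fields `φ`, `χ` of the same dimension `p`: in the conventions of the `σ–ε` system
(`SigmaEpsilonSystem`, `g(u,v)` stripped of `x_{12}^{-Δ₁-Δ₂} x_{34}^{-Δ₃-Δ₄} (x_{24}/x_{14})^{Δ₁₂} (x_{14}/x_{13})^{Δ₃₄}`)
`⟨χφφχ⟩ ↦ u^p v^{-p}` (the reflection-positive ordering, all terms `+λ²`) and `⟨φχφχ⟩ ↦ u^p` (the ordering
carrying the spin-parity sign `(-1)^ℓ`), the exchanged operators being the double-twist family `[φχ]_{n,ℓ}`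
of dimension `2p+2n+ℓ` and EVERY spin `ℓ` (Fitzpatrick–Kaplan 2012 §2.2, the closed form for `(c̄^{12}_{n,ℓ})²` at
`Δ₁ = Δ₂ = p`, `h = 3/2`, whose `(-1)^ℓ` is exactly this sign). They feed the odd sector (sum rules 3–5) of the
decoupled-pair witness of the full typed axioms (`DecoupledPairNonVacuity`).

Proof. (1) The degree identity of the `(u/v)^p` family alone, `mft_degree_identity_uv`:
`Σ_{n,ℓ ≤ N} P_{n,ℓ} [n ≤ i,k] k^{(2p+2n+ℓ,ℓ)}_{(i-n,k-n)} = (p)_i (p)_k/(i! k!)` (from `blockSum_mft_eq_ggArr`,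
`hrMonomialCoeff_shift`, `gg_conversion` — verbatim the route of `mft_degree_identity` with one family);
(2) Tonelli on the non-negative family exactly as in `hasSum_meanField_series`, giving the `z`-series form
`hasSum_mft_series_uv` with sum `(1-z)^{-p}(1-z̄)^{-p}`; (3) the `u^p` family is the DIFFERENCE
`hasSum_meanField_series - hasSum_mft_series_uv` (no second Tonelli argument: the signed family is the combined
even-spin family minus the positive one), sum `1`; (4) multiplication by `(z z̄)^p`.

References: A. L. Fitzpatrick, J. Kaplan, JHEP 10 (2012) 032, §2.2 [cite: FitzpatrickKaplan2012, §2.2];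
I. Heemskerk, J. Penedones, J. Polchinski, J. Sully, JHEP 10 (2009) 079, §2 [cite: HeemskerkPenedonesPolchinskiSully2009, §2];
M. Hogervorst, S. Rychkov, JHEP 06 (2013) 106, §2.1 eq. (2.16) [cite: HogervorstRychkov2013, §2.1 eq. (2.16)].
-/

namespace Literature.MathematicalPhysics.QuantumFieldTheory.ConformalBootstrap3D

open Finset Set Filter Topology

/-! ### 1. The degree identity of the `(u/v)^p` family -/

/-- **The degree identity of the `(u/v)^p` family**: for every `(i, k)` (`N = i + k`, `p > 1/2`),
`Σ_{n ≤ N} Σ_{ℓ ≤ N} P_{n,ℓ}(p) · [n ≤ i, n ≤ k] k^{(2p+2n+ℓ,ℓ)}_{(i-n,k-n)} = (p)_i (p)_k/(i! k!)` — the coefficient of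
`(z z̄)^p z^i z̄^k` in `(u/v)^p = Σ_{n,ℓ} P_{n,ℓ} g_{2p+2n+ℓ,ℓ}`. [cite: FitzpatrickKaplan2012, §2.2] -/
theorem mft_degree_identity_uv {p : ℝ} (hp : 1 / 2 < p) (i k N : ℕ) (hN : i + k = N) :
    ∑ n ∈ range (N + 1), ∑ ℓ ∈ range (N + 1), mftCoeff p n ℓ *
        (if n ≤ i ∧ n ≤ k then hrMonomialCoeff (2 * p + 2 * n + ℓ) ℓ (i - n, k - n) else 0) =
      poch p i * poch p k / ((i.factorial : ℝ) * k.factorial) := by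
  have step1 : ∀ n ∈ range (N + 1), ∑ ℓ ∈ range (N + 1), mftCoeff p n ℓ *
      (if n ≤ i ∧ n ≤ k then hrMonomialCoeff (2 * p + 2 * n + ℓ) ℓ (i - n, k - n) else 0) =
      ∑ j ∈ range (N + 1), ∑ ℓ ∈ range (N + 1),
        (mftCoeff p n ℓ / legendreLam ℓ * blockArr p n ℓ N j) * legendreArrDeg N j (i, k) := by
    intro n _
    rw [sum_comm]
    refine sum_congr rfl fun ℓ _ => ?_
    rw [hrMonomialCoeff_shift p n ℓ i k N hN, mul_sum]
    refine sum_congr rfl fun j _ => ?_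
    ring
  rw [sum_congr rfl step1, sum_comm]
  have step2 : ∀ j ∈ range (N + 1), ∑ n ∈ range (N + 1), ∑ ℓ ∈ range (N + 1),
      (mftCoeff p n ℓ / legendreLam ℓ * blockArr p n ℓ N j) * legendreArrDeg N j (i, k) =
      ggArr p N j * legendreArrDeg N j (i, k) := by
    intro j _
    rw [← congrFun (congrFun (blockSum_mft_eq_ggArr hp) N) j]
    unfold blockSum
    rw [Int.toNat_natCast, sum_mul]
    refine sum_congr rfl fun n _ => ?_
    rw [sum_mul]
  rw [sum_congr rfl step2, gg_conversion hp i k N hN]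

/-- **The degree identity of the `u^p` family**: for every `(i, k)` (`N = i + k`, `p > 1/2`),
`Σ_{n ≤ N} Σ_{ℓ ≤ N} (-1)^ℓ P_{n,ℓ}(p) · [n ≤ i, n ≤ k] k^{(2p+2n+ℓ,ℓ)}_{(i-n,k-n)} = δ_{N,0}` — the coefficient of
`(z z̄)^p z^i z̄^k` in `u^p = Σ_{n,ℓ} (-1)^ℓ P_{n,ℓ} g_{2p+2n+ℓ,ℓ}`. [cite: FitzpatrickKaplan2012, §2.2] -/
theorem mft_degree_identity_u {p : ℝ} (hp : 1 / 2 < p) (i k N : ℕ) (hN : i + k = N) :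
    ∑ n ∈ range (N + 1), ∑ ℓ ∈ range (N + 1), (-1 : ℝ) ^ ℓ * mftCoeff p n ℓ *
        (if n ≤ i ∧ n ≤ k then hrMonomialCoeff (2 * p + 2 * n + ℓ) ℓ (i - n, k - n) else 0) =
      if N = 0 then 1 else 0 := by
  have h := mft_degree_identity hp i k N hN
  have huv := mft_degree_identity_uv hp i k N hN
  have hsplit : ∑ n ∈ range (N + 1), ∑ ℓ ∈ range (N + 1), (1 + (-1 : ℝ) ^ ℓ) * mftCoeff p n ℓ *
        (if n ≤ i ∧ n ≤ k then hrMonomialCoeff (2 * p + 2 * n + ℓ) ℓ (i - n, k - n) else 0) =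
      ∑ n ∈ range (N + 1), ∑ ℓ ∈ range (N + 1), mftCoeff p n ℓ *
        (if n ≤ i ∧ n ≤ k then hrMonomialCoeff (2 * p + 2 * n + ℓ) ℓ (i - n, k - n) else 0) +
      ∑ n ∈ range (N + 1), ∑ ℓ ∈ range (N + 1), (-1 : ℝ) ^ ℓ * mftCoeff p n ℓ *
        (if n ≤ i ∧ n ≤ k then hrMonomialCoeff (2 * p + 2 * n + ℓ) ℓ (i - n, k - n) else 0) := by
    rw [← sum_add_distrib]
    refine sum_congr rfl fun n _ => ?_
    rw [← sum_add_distrib]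
    refine sum_congr rfl fun ℓ _ => ?_
    ring
  rw [hsplit, huv] at h
  linarith

/-! ### 2. The `z`-series forms -/

/-- **The `(u/v)^p` decomposition, `z`-series form**: for `z, z̄ ∈ (0,1)` and `p > 1/2`,
`Σ_{n,ℓ} P_{n,ℓ}(p) (z z̄)^n K^{HR}_{2p+2n+ℓ,ℓ}(z,z̄) = (1-z)^{-p}(1-z̄)^{-p}`, all terms non-negative (Tonelli on the
family `P_{n,ℓ} [n ≤ i,k] k^{(n,ℓ)}_{(i-n,k-n)} z^i z̄^k`, the degree identity `mft_degree_identity_uv`, and the binomial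
series). [cite: FitzpatrickKaplan2012, §2.2] -/
theorem hasSum_mft_series_uv {p : ℝ} (hp : 1 / 2 < p) {z zb : ℝ} (hz : z ∈ Ioo (0 : ℝ) 1)
    (hzb : zb ∈ Ioo (0 : ℝ) 1) :
    HasSum (fun m : ℕ × ℕ => mftCoeff p m.1 m.2 *
        ((z * zb) ^ m.1 * hrSeries (2 * p + 2 * m.1 + m.2) m.2 z zb))
      (1 / (1 - z) ^ p * (1 / (1 - zb) ^ p)) := by
  -- the non-negative family on `(ℕ × ℕ) × (ℕ × ℕ)` (monomial index, operator index)
  set F : (ℕ × ℕ) × (ℕ × ℕ) → ℝ := fun qm => mftCoeff p qm.2.1 qm.2.2 *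
    ((if qm.2.1 ≤ qm.1.1 ∧ qm.2.1 ≤ qm.1.2 then
        hrMonomialCoeff (2 * p + 2 * qm.2.1 + qm.2.2) qm.2.2 (qm.1.1 - qm.2.1, qm.1.2 - qm.2.1) else 0) *
      z ^ qm.1.1 * zb ^ qm.1.2) with hF
  set V : ℕ × ℕ → ℝ := fun q =>
    poch p q.1 * poch p q.2 / ((q.1.factorial : ℝ) * q.2.factorial) * (z ^ q.1 * zb ^ q.2) with hV
  -- fibre sums over the operator index: the degree identity
  have hinner : ∀ q : ℕ × ℕ, HasSum (fun m => F (q, m)) (V q) := by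
    intro q
    set N := q.1 + q.2 with hN
    have hzero : ∀ m ∉ range (N + 1) ×ˢ range (N + 1), F (q, m) = 0 := by
      intro m hm
      rw [Finset.mem_product, Finset.mem_range, Finset.mem_range, not_and_or, not_lt, not_lt] at hm
      simp only [hF]
      rcases hm with h1 | h2
      · rw [if_neg (by omega)]; ring
      · split_ifs with hc
        · rw [hrMonomialCoeff_eq_zero_of_lt _ _ (by simp only; omega)]; ring
        · ring
    have hfin : HasSum (fun m => F (q, m)) (∑ m ∈ range (N + 1) ×ˢ range (N + 1), F (q, m)) :=
      hasSum_sum_of_ne_finset_zero hzero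
    have hval : ∑ m ∈ range (N + 1) ×ˢ range (N + 1), F (q, m) = V q := by
      rw [Finset.sum_product, hV]
      simp only
      rw [← mft_degree_identity_uv hp q.1 q.2 N hN.symm, sum_mul]
      refine sum_congr rfl fun n _ => ?_
      rw [sum_mul]
      refine sum_congr rfl fun ℓ _ => ?_
      simp only [hF]
      ring
    rwa [hval] at hfin
  -- the fibre sums form the Cauchy square of the binomial series
  have hVsum : HasSum V (1 / (1 - z) ^ p * (1 / (1 - zb) ^ p)) := by
    have h1 := hasSum_poch_div_factorial_mul_pow p (x := z) (by rw [abs_of_pos hz.1]; exact hz.2)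
    have h2 := hasSum_poch_div_factorial_mul_pow p (x := zb) (by rw [abs_of_pos hzb.1]; exact hzb.2)
    have hp0 : 0 < p := by linarith
    have hnn1 : 0 ≤ fun n => poch p n / (n.factorial : ℝ) * z ^ n := fun n =>
      mul_nonneg (div_nonneg (poch_pos hp0 n).le (by positivity)) (pow_nonneg hz.1.le n)
    have hnn2 : 0 ≤ fun n => poch p n / (n.factorial : ℝ) * zb ^ n := fun n =>
      mul_nonneg (div_nonneg (poch_pos hp0 n).le (by positivity)) (pow_nonneg hzb.1.le n)
    have hprod := h1.mul h2 (h1.summable.mul_of_nonneg h2.summable hnn1 hnn2)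
    have hVeq : V = fun q : ℕ × ℕ =>
        poch p q.1 / (q.1.factorial : ℝ) * z ^ q.1 * (poch p q.2 / (q.2.factorial : ℝ) * zb ^ q.2) := by
      funext q
      simp only [hV]
      ring
    rw [hVeq]
    exact hprod
  -- Tonelli: the family is summable, with total the sum of the fibre sums
  have hFnn : 0 ≤ F := by
    intro qm
    simp only [hF, Pi.zero_apply]
    refine mul_nonneg (mftCoeff_nonneg hp _ _)
      (mul_nonneg (mul_nonneg ?_ (pow_nonneg hz.1.le _)) (pow_nonneg hzb.1.le _))
    split_ifs
    · exact hrMonomialCoeff_nonneg (unitarityBound3D_lt_twist hp _ _) _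
    · exact le_rfl
  have hFsum : Summable F := by
    refine (summable_prod_of_nonneg hFnn).mpr ⟨fun q => (hinner q).summable, ?_⟩
    have : (fun q : ℕ × ℕ => ∑' m, F (q, m)) = V := funext fun q => (hinner q).tsum_eq
    rw [this]
    exact hVsum.summable
  have htot : HasSum F (∑' qm, F qm) := hFsum.hasSum
  have hval : ∑' qm, F qm = 1 / (1 - z) ^ p * (1 / (1 - zb) ^ p) :=
    (htot.prod_fiberwise hinner).unique hVsum
  -- and, summing the other way, the total is the block series
  have hswap : HasSum (fun mq : (ℕ × ℕ) × (ℕ × ℕ) => F (mq.2, mq.1)) (∑' qm, F qm) :=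
    (Equiv.prodComm (ℕ × ℕ) (ℕ × ℕ)).hasSum_iff.mpr htot
  have hrow : ∀ m : ℕ × ℕ, HasSum (fun q : ℕ × ℕ => F (q, m))
      (mftCoeff p m.1 m.2 * ((z * zb) ^ m.1 * hrSeries (2 * p + 2 * m.1 + m.2) m.2 z zb)) := fun m =>
    (hasSum_hrMonomialCoeff_shift (unitarityBound3D_lt_twist hp m.1 m.2) m.1 hz hzb).mul_left _
  rw [← hval]
  exact hswap.prod_fiberwise hrow

/-- **The `u^p` decomposition, `z`-series form**: for `z, z̄ ∈ (0,1)` and `p > 1/2`,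
`Σ_{n,ℓ} (-1)^ℓ P_{n,ℓ}(p) (z z̄)^n K^{HR}_{2p+2n+ℓ,ℓ}(z,z̄) = 1` — the difference of the even-spin identity
`hasSum_meanField_series` and `hasSum_mft_series_uv` (absolutely convergent: dominated by the latter).
[cite: FitzpatrickKaplan2012, §2.2] -/
theorem hasSum_mft_series_u {p : ℝ} (hp : 1 / 2 < p) {z zb : ℝ} (hz : z ∈ Ioo (0 : ℝ) 1)
    (hzb : zb ∈ Ioo (0 : ℝ) 1) :
    HasSum (fun m : ℕ × ℕ => (-1 : ℝ) ^ m.2 * mftCoeff p m.1 m.2 *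
        ((z * zb) ^ m.1 * hrSeries (2 * p + 2 * m.1 + m.2) m.2 z zb)) 1 := by
  have h := (hasSum_meanField_series hp hz hzb).sub (hasSum_mft_series_uv hp hz hzb)
  have hfun : (fun m : ℕ × ℕ => (-1 : ℝ) ^ m.2 * mftCoeff p m.1 m.2 *
      ((z * zb) ^ m.1 * hrSeries (2 * p + 2 * m.1 + m.2) m.2 z zb)) =
      fun m : ℕ × ℕ => (1 + (-1 : ℝ) ^ m.2) * mftCoeff p m.1 m.2 *
          ((z * zb) ^ m.1 * hrSeries (2 * p + 2 * m.1 + m.2) m.2 z zb) -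
        mftCoeff p m.1 m.2 * ((z * zb) ^ m.1 * hrSeries (2 * p + 2 * m.1 + m.2) m.2 z zb) := by
    funext m
    ring
  rw [show 1 / (1 - z) ^ p * (1 / (1 - zb) ^ p) + 1 - 1 / (1 - z) ^ p * (1 / (1 - zb) ^ p) = (1 : ℝ) by ring]
    at h
  rw [hfun]
  exact h

/-! ### 3. The block forms -/

/-- Rewriting a double-twist block as `(z z̄)^p` times its shifted `z`-series. [cite: HogervorstRychkov2013, §2.1 eq. (2.16)] -/
theorem hrBlock_twist_eq {p : ℝ} (n ℓ : ℕ) {z zb : ℝ} (hz : 0 < z) (hzb : 0 < zb) :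
    hrBlock (2 * p + 2 * n + ℓ) ℓ z zb = (z * zb) ^ p * ((z * zb) ^ n * hrSeries (2 * p + 2 * n + ℓ) ℓ z zb) := by
  unfold hrBlock
  have hu : 0 < z * zb := mul_pos hz hzb
  have e : (2 * p + 2 * (n : ℝ) + (ℓ : ℝ) - (ℓ : ℝ)) / 2 = p + (n : ℝ) := by ring
  rw [e, Real.rpow_add hu, Real.rpow_natCast]
  ring

/-- **`(u/v)^p = Σ_{n,ℓ} P_{n,ℓ}(p) g_{2p+2n+ℓ,ℓ}` on the open square** (`p > 1/2`; all spins, all coefficients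
positive): the conformal block decomposition of the reflection-positive ordering `⟨χφφχ⟩` of two decoupled
generalised free fields of dimension `p`, in the typed blocks `hrBlock`. [cite: FitzpatrickKaplan2012, §2.2] -/
theorem hasSum_mft_blocks_uv {p : ℝ} (hp : 1 / 2 < p) {z zb : ℝ} (hz : z ∈ Ioo (0 : ℝ) 1)
    (hzb : zb ∈ Ioo (0 : ℝ) 1) :
    HasSum (fun m : ℕ × ℕ => mftCoeff p m.1 m.2 * hrBlock (2 * p + 2 * m.1 + m.2) m.2 z zb)
      ((z * zb) ^ p / ((1 - z) * (1 - zb)) ^ p) := by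
  have h := (hasSum_mft_series_uv hp hz hzb).mul_left ((z * zb) ^ p)
  have hfun : (fun m : ℕ × ℕ => mftCoeff p m.1 m.2 * hrBlock (2 * p + 2 * m.1 + m.2) m.2 z zb) =
      fun m => (z * zb) ^ p * (mftCoeff p m.1 m.2 *
        ((z * zb) ^ m.1 * hrSeries (2 * p + 2 * m.1 + m.2) m.2 z zb)) := by
    funext m
    rw [hrBlock_twist_eq m.1 m.2 hz.1 hzb.1]
    ring
  have hval : (z * zb) ^ p / ((1 - z) * (1 - zb)) ^ p = (z * zb) ^ p * (1 / (1 - z) ^ p * (1 / (1 - zb) ^ p)) := by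
    rw [Real.mul_rpow (x := 1 - z) (y := 1 - zb) (sub_nonneg.mpr hz.2.le) (sub_nonneg.mpr hzb.2.le)]
    have h1 : 0 < (1 - z) ^ p := Real.rpow_pos_of_pos (by linarith [hz.2]) _
    have h2 : 0 < (1 - zb) ^ p := Real.rpow_pos_of_pos (by linarith [hzb.2]) _
    field_simp
  rw [hfun, hval]
  exact h

/-- **`u^p = Σ_{n,ℓ} (-1)^ℓ P_{n,ℓ}(p) g_{2p+2n+ℓ,ℓ}` on the open square** (`p > 1/2`): the conformal block
decomposition of the ordering `⟨φχφχ⟩` of two decoupled generalised free fields of dimension `p`, in the typed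
blocks `hrBlock`; the spin-parity sign `(-1)^ℓ` of Fitzpatrick–Kaplan's formula is the sign of sum rule 3 of the
`σ–ε` system. [cite: FitzpatrickKaplan2012, §2.2] -/
theorem hasSum_mft_blocks_u {p : ℝ} (hp : 1 / 2 < p) {z zb : ℝ} (hz : z ∈ Ioo (0 : ℝ) 1)
    (hzb : zb ∈ Ioo (0 : ℝ) 1) :
    HasSum (fun m : ℕ × ℕ => (-1 : ℝ) ^ m.2 * mftCoeff p m.1 m.2 * hrBlock (2 * p + 2 * m.1 + m.2) m.2 z zb)
      ((z * zb) ^ p) := by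
  have h := (hasSum_mft_series_u hp hz hzb).mul_left ((z * zb) ^ p)
  have hfun : (fun m : ℕ × ℕ => (-1 : ℝ) ^ m.2 * mftCoeff p m.1 m.2 * hrBlock (2 * p + 2 * m.1 + m.2) m.2 z zb) =
      fun m => (z * zb) ^ p * ((-1 : ℝ) ^ m.2 * mftCoeff p m.1 m.2 *
        ((z * zb) ^ m.1 * hrSeries (2 * p + 2 * m.1 + m.2) m.2 z zb)) := by
    funext m
    rw [hrBlock_twist_eq m.1 m.2 hz.1 hzb.1]
    ring
  rw [mul_one] at h
  rw [hfun]
  exact h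

/-- The `(u/v)^p` decomposition converges in particular on the diagonal `z = z̄ = x` — the convergence clause of
A1 for `⟨εσσε⟩` in the decoupled pair. [folklore] -/
theorem summable_mft_blocks_uv_diag {p : ℝ} (hp : 1 / 2 < p) {x : ℝ} (hx0 : 0 < x) (hx1 : x < 1) :
    Summable (fun m : ℕ × ℕ => mftCoeff p m.1 m.2 * hrBlock (2 * p + 2 * m.1 + m.2) m.2 x x) :=
  (hasSum_mft_blocks_uv hp ⟨hx0, hx1⟩ ⟨hx0, hx1⟩).summable

end Literature.MathematicalPhysics.QuantumFieldTheory.ConformalBootstrap3D
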